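import Literature.AlgebraicGeometry.Motives.HodgeLieUnitaryTimesCMCurveSU
import Literature.AlgebraicGeometry.Motives.HodgeLieRigid
import Literature.AlgebraicGeometry.Motives.HodgeLieProductSimpleFactor
import HarnessLib

/-!
# The Weil PRODUCT brick for a summand with ABELIAN Hodge Lie algebra: `𝔥(H₁ ⊕ H₂)_ℂ` contains every block-diagonal `K`-linear `ψ_ℂ`-skew operator with trace `0` on `W_K` whose `V₂`-corner lies in `𝔥(H₂)_ℂ` — `H₁` unitary with the displayed Lie input, `H₂` of CM type of ANY rank (Moonen–Zarhin 1999 §3 (3.1), (3.6)–(3.8); Deligne I §3)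

Family `hodge`, layer `Literature/AlgebraicGeometry/Motives`, namespace `Literature.AlgebraicGeometry.Motives.HodgeStructure`,
sub-namespace `WeilProductCM` (the brick K1 of the cell `pub-hodgeav-hg6`, req-37 (A) Q2b, TABLE X Weil PRODUCT rows; this is
its version v1.2 for a CM SUMMAND of any rank — row 22 `Y₃ × Z₃`, `Z₃` a simple CM threefold —, written against the interface of
K1 v1 = `Motives/HodgeLieUnitaryTimesCMCurveSU` (eng-5), whose binder conventions and argument order it keeps).  THEOREMS ONLY
(no definition, no named fact, no instance, no `sorry`).  HONEST FRAMING of the cell: HC ∕ HC_AV (stmt-1333) ∕ HC_CM (stmt-3052)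
∕ H2 are NOT proved anywhere in this file; this is unconditional linear algebra of polarized weight-one `ℚ`-Hodge structures.

SETTING = K1 v1's (`Motives/HodgeLieTimesCMCurve`): `H = H₁ ⊕ H₂` presented by Hodge morphisms `ι_i`, `π_i` (`π_i ι_i = 1`,
`ι₁π₁ + ι₂π₂ = 1`), weight `1`, `ψ` ANY polarization of `H`; `φ₁ ∈ End_Hdg(H₁)`, `φ₂ ∈ End(V₂)` with `φ_i² = −d` (`d > 0`) glued
to a Hodge endomorphism `Φ` of `H` (the diagonal `K`); `μ² = −d`, `W_K = ker(Φ_ℂ − μ)`; BALANCE (Weil type) at `± μ`; on `H₁`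
the displayed inputs `hLie₁` (the `∀`-admissible-`𝔤₁` unitary Lie theorem, ⟸ `UnitaryHodgeGroupAdmissibleOfRibetType` per row)
and `hSL₁` («`𝔰𝔲_K(V₁)_ℂ = [𝔲, 𝔲]`», ⟸ K1b `UnitarySU.mem_span_commutator_of_trace`), quantified over ALL `ψ₁`.
WHAT CHANGES w.r.t. v1 (CM curve, `dim V₂ = 2`): the second summand is now ANY `H₂` with ABELIAN Hodge Lie algebra
(`hab₂` — «`H₂` of CM type», Moonen–Zarhin §1; `E_K`, `E_K²`, a simple CM threefold, …), and the operator `Y` carries ONE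
more hypothesis, `hY₂`: its `V₂`-corner `π₂,ℂ Y ι₂,ℂ` lies in `𝔥(H₂)_ℂ` (for a CM curve automatic by `RankTwoCM`; for `Z₃` it
is the torus maximality `𝔥(H¹Z₃) ⊇ F⁻` of `HodgeTheory/CMAbelianVarietyHodgeLieTorusOfNondegenerate` + Rosati).  No rank, no
field structure and no non-resonance enter: the tree's **`hodgeLie_rigid`** (every polarizable Hodge structure is Θ-rigid) with
`hodgeLie_eq_map_restrict_of_rigid` gives the corner surjectivity `𝔥(H₂) = π₂ 𝔥(H) ι₂` for free (§1), and the `W_K`-trace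
bookkeeping of v1 (only for `Θ_H`) is replaced by «`Tr(Φ_ℂ X) = 0` for EVERY `X ∈ 𝔥(H)_ℂ`» (§0: a Hodge endomorphism
trace-orthogonal to `Θ` is trace-orthogonal to all of `Lie Hg`, by rigidity — the argument of the tree's
`CMThetaKWeil.trace_mul_eq_zero_of_mem_hodgeLie` with the CM trace computation replaced by the hypothesis `Tr(y_ℂ Θ) = 0`).

INSTANCES (one brick family {v1, v1.2} for all four product rows): `V₂ = H¹(E_K)` (rows 17: v1, where `hY₂` and `hab₂` are
automatic by `RankTwoCM`); `V₂ = H¹(E_K²)` (row 20: `hab₂` ⟸ the Hodge group of `E_K²` is a torus, `hY₂` ⟸ the row-20 factor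
lemma «commutes with `M₂(K)_ℂ` and skew ⟹ in `ℂ φ₂,ℂ ⊆ 𝔥(H¹E_K²)_ℂ`»); `V₂ = H¹(Z₃)`, `Z₃` a SIMPLE CM threefold (row 22:
`hab₂` ⟸ `End⁰(Z₃) = F` commutative, `hY₂` ⟸ `HodgeTheory/CMAbelianVarietyHodgeLieTorusOfNondegenerate` (F22b) + the Rosati
compatibility of the restricted polarization).

* §0 **`WeilProductCM.trace_mul_eq_zero_of_mem_hodgeLie_of_trace_theta`** (+ `…hodgeLieC…`): `y ∈ End_Hdg(H)`,
  `Tr(y_ℂ Θ) = 0` ⟹ `Tr(y X) = 0` on `𝔥(H)` (and `Tr(y_ℂ X) = 0` on `𝔥(H)_ℂ`).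
* §1 **`WeilProductCM.exists_mem_hodgeLieC_restrict₂_eq`** (every `z ∈ 𝔥(H₂)_ℂ` is the `V₂`-corner of some `X ∈ 𝔥(H)_ℂ`),
  **`WeilProductCM.restrict₂_commutator_eq_zero_of_abelian`** (brackets of `𝔥(H)` have zero `V₂`-corner when `𝔥(H₂)` is abelian).
* §2 **`WeilProductCM.mem_hodgeLieC_of_commute_of_skew_of_trace_of_abelian`** — THE BRICK.  PROOF (Goursat, as v1): pick
  `X ∈ 𝔥(H)_ℂ` with the `V₂`-corner of `Y` (§1, `hY₂`); `Z = Y − X` is block diagonal with zero `V₂`-block, so `Z = ι₁ T π₁` with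
  `T` commuting with `φ₁,ℂ`, skew for `ψ ∘ (ι₁ × ι₁)`, and `tr(φ₁,ℂ T) = tr(Φ_ℂ Z) = tr(Φ_ℂ Y) − tr(Φ_ℂ X) = 0 − 0` (`Y`: the
  `W_K`-trace hypothesis; `X`: §0 with the balance `tr(Θ_H Φ_ℂ) = 0`); `hSL₁` writes `T` in brackets of `φ₁,ℂ`-commuting skew
  operators, `hLie₁` (on the corner algebra `π₁ 𝔥(H) ι₁ ∋_ℂ Θ₁`) puts those in `(π₁ 𝔥(H) ι₁)_ℂ`, and brackets of corners lift
  (`ι₁ [π₁Xι₁, π₁X′ι₁] π₁ = [X, X′]`, §1); so `Y = X + ι₁ T π₁ ∈ 𝔥(H)_ℂ`.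

## References
* [MoonenZarhin1999LowDim] B. Moonen, Yu. Zarhin, Math. Ann. 315 (1999), §2 (2.1)–(2.3), §3 (3.1), Lemma (3.6), Prop. (3.8), §5.
* [MoonenZarhin1998WeilClasses] B. Moonen, Yu. Zarhin, J. reine angew. Math. 496 (1998), §4 Remark (1) (`Hdg ⊂ SU_K`).
* [Deligne1982HodgeCycles] P. Deligne, LNM 900 (1982), I §3 Prop. 3.4 (and its proof), Prop. 3.6; §4 (p. 30).
* [Ribet1983] K. A. Ribet, Amer. J. Math. 105 (1983), Thm. 3.
-/

noncomputable section

open scoped TensorProduct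

namespace Literature.AlgebraicGeometry.Motives

namespace HodgeStructure

universe u

/-! ## §0 A Hodge endomorphism trace-orthogonal to `Θ` is trace-orthogonal to `Lie Hg` -/

section TraceOrthogonal

variable {V : Type u} [AddCommGroup V] [Module ℚ V] {n : ℤ}

/-- Descent for one rational linear condition (private copy of the tree's `CMThetaKWeil.mem_spanC_inf_ker`, kept private to
keep the `Motives` layer free of `HodgeTheory` imports): `D ∈ 𝔥_ℂ` with `g(D) = 0`, `g(X_ℂ) = f(X)` on `𝔥` ⟹ `D ∈ (𝔥 ∩ ker f)_ℂ`.
[cite: Deligne1982HodgeCycles, I §3 (proof of Prop. 3.4)] -/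
private theorem mem_spanC_inf_ker' {𝔥 : Submodule ℚ (Module.End ℚ V)} (f : Module.End ℚ V →ₗ[ℚ] ℚ)
    (g : Module.End ℂ (ℂ ⊗[ℚ] V) →ₗ[ℂ] ℂ) (hfg : ∀ X ∈ 𝔥, g (X.baseChange ℂ) = (f X : ℂ))
    {D : Module.End ℂ (ℂ ⊗[ℚ] V)} (hD : D ∈ spanC 𝔥) (hgD : g D = 0) : D ∈ spanC (𝔥 ⊓ LinearMap.ker f) := by
  have hg0 : ∀ A ∈ spanC (𝔥 ⊓ LinearMap.ker f), g A = 0 := by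
    intro A hA
    unfold spanC at hA
    induction hA using Submodule.span_induction with
    | mem A hA =>
      obtain ⟨X, hX, rfl⟩ := hA
      rw [hfg X hX.1, LinearMap.mem_ker.1 hX.2, Rat.cast_zero]
    | zero => rw [map_zero]
    | add A A' _ _ h h' => rw [map_add, h, h', add_zero]
    | smul c A _ h => rw [map_smul, h, smul_zero]
  by_cases hf : ∀ X ∈ 𝔥, f X = 0
  · have heq : 𝔥 ⊓ LinearMap.ker f = 𝔥 := inf_eq_left.2 fun X hX => LinearMap.mem_ker.2 (hf X hX)
    rw [heq]; exact hD
  push Not at hf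
  obtain ⟨X₀, hX₀, hfX₀⟩ := hf
  have hle : spanC 𝔥 ≤ spanC (𝔥 ⊓ LinearMap.ker f) ⊔ (ℂ ∙ X₀.baseChange ℂ) := by
    unfold spanC
    refine Submodule.span_le.2 ?_
    rintro _ ⟨X, hX, rfl⟩
    have hsplit : X.baseChange ℂ = (X - (f X / f X₀) • X₀).baseChange ℂ + ((f X / f X₀ : ℚ) : ℂ) • X₀.baseChange ℂ := by
      rw [LinearMap.baseChange_sub, LinearMap.baseChange_smul, ← algebraMap_smul ℂ (f X / f X₀) (X₀.baseChange ℂ),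
        eq_ratCast, sub_add_cancel]
    change X.baseChange ℂ ∈ _
    rw [hsplit]
    refine Submodule.add_mem _ (Submodule.mem_sup_left (Submodule.subset_span ⟨_, ⟨Submodule.sub_mem _ hX
      (Submodule.smul_mem _ _ hX₀), ?_⟩, rfl⟩)) (Submodule.mem_sup_right (Submodule.smul_mem _ _
      (Submodule.mem_span_singleton_self _)))
    rw [SetLike.mem_coe, LinearMap.mem_ker, map_sub, map_smul, smul_eq_mul, div_mul_cancel₀ _ hfX₀, sub_self]
  obtain ⟨A, hA, B, hB, hAB⟩ := Submodule.mem_sup.1 (hle hD)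
  obtain ⟨c, rfl⟩ := Submodule.mem_span_singleton.1 hB
  have hc : c = 0 := by
    have h := hgD
    rw [← hAB, map_add, hg0 A hA, zero_add, map_smul, hfg X₀ hX₀, smul_eq_mul] at h
    exact (mul_eq_zero.1 h).resolve_right (by exact_mod_cast hfX₀)
  rw [← hAB, hc, zero_smul, add_zero]
  exact hA

/-- **`Tr(y_ℂ Θ) = 0 ⟹ Tr(y X) = 0` on `Lie Hg`** for a Hodge endomorphism `y` of a polarized `H`: the subspace
`{X ∈ 𝔥(H) : Tr(yX) = 0}` is rational, bracket-closed (`y` commutes with `𝔥(H)`) and its complex span contains the Hodge operator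
`Θ` (descent), so it is all of `𝔥(H)` by RIGIDITY (`hodgeLie_rigid`, Moonen–Zarhin (3.1)).  The tree's
`CMThetaKWeil.trace_mul_eq_zero_of_mem_hodgeLie` is the special case where `Tr(y_ℂ Θ)` is computed from CM block data; here the
vanishing is the hypothesis. [cite: MoonenZarhin1999LowDim, §3 (3.1)] [cite: MoonenZarhin1998WeilClasses, §4 Remark (1)]
[cite: Deligne1982HodgeCycles, I §3 (proof of Prop. 3.4)] -/
theorem WeilProductCM.trace_mul_eq_zero_of_mem_hodgeLie_of_trace_theta [Module.Finite ℚ V] [HodgeTensorFacts.{u, u}]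
    (H : HodgeStructure V n) (ψ : H.Polarization) {y : Module.End ℚ V} (hyE : y ∈ H.endAlg)
    {Θ : Module.End ℂ (ℂ ⊗[ℚ] V)} (hΘ : ∀ p, ∀ x ∈ H.piece p (n - p), Θ x = ((2 * p - n : ℤ) : ℂ) • x)
    (hyΘ : LinearMap.trace ℂ _ (y.baseChange ℂ * Θ) = 0) :
    ∀ X ∈ H.hodgeLie, LinearMap.trace ℚ V (y * X) = 0 := by
  classical
  haveI : Module.Free ℚ V := Module.Free.of_divisionRing ℚ V
  set f : Module.End ℚ V →ₗ[ℚ] ℚ := LinearMap.trace ℚ V ∘ₗ LinearMap.mulLeft ℚ y with hfdef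
  have hf : ∀ X, f X = LinearMap.trace ℚ V (y * X) := fun X => rfl
  set g : Module.End ℂ (ℂ ⊗[ℚ] V) →ₗ[ℂ] ℂ := LinearMap.trace ℂ _ ∘ₗ LinearMap.mulLeft ℂ (y.baseChange ℂ) with hgdef
  have hg : ∀ D, g D = LinearMap.trace ℂ _ (y.baseChange ℂ * D) := fun D => rfl
  have hfg : ∀ X ∈ H.hodgeLie, g (X.baseChange ℂ) = (f X : ℂ) := fun X _ => by
    rw [hg, hf, ← LinearMap.baseChange_mul, LinearMap.trace_baseChange, eq_ratCast]
  set 𝔞 : Submodule ℚ (Module.End ℚ V) := H.hodgeLie ⊓ LinearMap.ker f with h𝔞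
  have hbr : ∀ X ∈ 𝔞, ∀ X' ∈ 𝔞, X * X' - X' * X ∈ 𝔞 := by
    intro X hX X' hX'
    refine ⟨H.commutator_mem_hodgeLie hX.1 hX'.1, LinearMap.mem_ker.2 ?_⟩
    have hyX' : X' * y = y * X' := H.commute_of_mem_hodgeLie hX'.1 ⟨y, hyE⟩
    rw [hf, mul_sub, map_sub, ← mul_assoc, ← mul_assoc, ← hyX', mul_assoc X' y X, LinearMap.trace_mul_comm ℚ X',
      mul_assoc, sub_self]
  have hΘC : Θ ∈ H.hodgeLieC := H.mem_hodgeLieC_of_forall_piece hΘ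
  have hgΘ : g Θ = 0 := by rw [hg]; exact hyΘ
  have hΘ𝔞 : Θ ∈ spanC 𝔞 := by
    rw [h𝔞]
    exact mem_spanC_inf_ker' f g hfg ((hodgeLieC_eq_spanC H) ▸ hΘC) hgΘ
  have hle : H.hodgeLie ≤ 𝔞 := hodgeLie_rigid H ⟨ψ⟩ 𝔞 inf_le_left hbr ⟨Θ, hΘ𝔞, hΘ⟩
  intro X hX
  rw [← hf]
  exact LinearMap.mem_ker.1 (hle hX).2

/-- **Complex form**: `Tr(y_ℂ X) = 0` for every `X ∈ 𝔥(H)_ℂ`, for a Hodge endomorphism `y` with `Tr(y_ℂ Θ) = 0`.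
[cite: MoonenZarhin1999LowDim, §3 (3.1)] [cite: MoonenZarhin1998WeilClasses, §4 Remark (1)] -/
theorem WeilProductCM.trace_mul_eq_zero_of_mem_hodgeLieC_of_trace_theta [Module.Finite ℚ V] [HodgeTensorFacts.{u, u}]
    (H : HodgeStructure V n) (ψ : H.Polarization) {y : Module.End ℚ V} (hyE : y ∈ H.endAlg)
    {Θ : Module.End ℂ (ℂ ⊗[ℚ] V)} (hΘ : ∀ p, ∀ x ∈ H.piece p (n - p), Θ x = ((2 * p - n : ℤ) : ℂ) • x)
    (hyΘ : LinearMap.trace ℂ _ (y.baseChange ℂ * Θ) = 0) {X : Module.End ℂ (ℂ ⊗[ℚ] V)} (hX : X ∈ H.hodgeLieC) :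
    LinearMap.trace ℂ _ (y.baseChange ℂ * X) = 0 := by
  have hQ := WeilProductCM.trace_mul_eq_zero_of_mem_hodgeLie_of_trace_theta H ψ hyE hΘ hyΘ
  rw [hodgeLieC_eq_spanC] at hX
  unfold spanC at hX
  induction hX using Submodule.span_induction with
  | mem X h =>
    obtain ⟨X₀, hX₀, rfl⟩ := h
    rw [← LinearMap.baseChange_mul, LinearMap.trace_baseChange, hQ X₀ hX₀, map_zero]
  | zero => rw [mul_zero, map_zero]
  | add X X' _ _ h h' => rw [mul_add, map_add, h, h', add_zero]
  | smul c X _ h => rw [mul_smul_comm, map_smul, h, smul_zero]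

end TraceOrthogonal

/-! ## §1 Corner surjectivity onto a summand (by rigidity); brackets have zero corner on an abelian summand -/

variable {V₁ : Type u} [AddCommGroup V₁] [Module ℚ V₁] [Module.Finite ℚ V₁]
  {V₂ : Type u} [AddCommGroup V₂] [Module ℚ V₂] [Module.Finite ℚ V₂]
  {V : Type u} [AddCommGroup V] [Module ℚ V] [Module.Finite ℚ V] [HodgeTensorFacts.{u, u}] {n : ℤ}
  {H₁ : HodgeStructure V₁ n} {H₂ : HodgeStructure V₂ n} {H : HodgeStructure V n}

/-- **Every `z ∈ 𝔥(H₂)_ℂ` is the `V₂`-corner `π₂,ℂ X ι₂,ℂ` of some `X ∈ 𝔥(H)_ℂ`** for a retract summand `ι₂ : H₂ → H`, `π₂ ι₂ = 1`,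
with `H₂` polarized: the projection `𝔥(H) → 𝔥(H₂)` is ONTO (`hodgeLie_eq_map_restrict_of_rigid` with the tree's `hodgeLie_rigid`:
every polarizable Hodge structure is Θ-rigid — Moonen–Zarhin (3.1) «the projections `Hg(X₁ × X₂) → Hg(X_i)` are surjective»),
complexified. [cite: MoonenZarhin1999LowDim, §3 (3.1)] [cite: Deligne1982HodgeCycles, I §3 Prop. 3.4] -/
theorem WeilProductCM.exists_mem_hodgeLieC_restrict₂_eq (ι₂ : Hom H₂ H) (π₂ : Hom H H₂)
    (hπι₂ : ∀ v, π₂.toLinearMap (ι₂.toLinearMap v) = v) (ψ₂ : H₂.Polarization) {z : Module.End ℂ (ℂ ⊗[ℚ] V₂)}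
    (hz : z ∈ H₂.hodgeLieC) :
    ∃ X ∈ H.hodgeLieC, π₂.toLinearMap.baseChange ℂ ∘ₗ X ∘ₗ ι₂.toLinearMap.baseChange ℂ = z := by
  have heq := hodgeLie_eq_map_restrict_of_rigid ι₂ π₂ hπι₂ (hodgeLie_rigid H₂ ⟨ψ₂⟩)
  rw [hodgeLieC_eq_spanC] at hz
  unfold spanC at hz
  induction hz using Submodule.span_induction with
  | mem z h =>
    obtain ⟨Z₀, hZ₀, rfl⟩ := h
    rw [heq] at hZ₀
    obtain ⟨X₀, hX₀, rfl⟩ := Submodule.mem_map.1 hZ₀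
    refine ⟨X₀.baseChange ℂ, baseChange_mem_hodgeLieC H hX₀, ?_⟩
    change π₂.toLinearMap.baseChange ℂ ∘ₗ X₀.baseChange ℂ ∘ₗ ι₂.toLinearMap.baseChange ℂ =
      (π₂.toLinearMap ∘ₗ X₀ ∘ₗ ι₂.toLinearMap).baseChange ℂ
    rw [LinearMap.baseChange_comp, LinearMap.baseChange_comp]
  | zero => exact ⟨0, Submodule.zero_mem _, by rw [LinearMap.zero_comp, LinearMap.comp_zero]⟩
  | add z z' _ _ h h' =>
    obtain ⟨X, hX, rfl⟩ := h
    obtain ⟨X', hX', rfl⟩ := h'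
    exact ⟨X + X', Submodule.add_mem _ hX hX', by rw [LinearMap.add_comp, LinearMap.comp_add]⟩
  | smul c z _ h =>
    obtain ⟨X, hX, rfl⟩ := h
    exact ⟨c • X, Submodule.smul_mem _ c hX, by rw [LinearMap.smul_comp, LinearMap.comp_smul]⟩

/-- **Brackets of `𝔥(H)` have zero `V₂`-corner when `𝔥(H₂)` is abelian** (`π₂ [X, X′] ι₂ = [π₂Xι₂, π₂X′ι₂] = 0`: the corner
map is multiplicative on `𝔥(H)` and lands in `𝔥(H₂)`).  For a CM curve this is the tree's `restrict₂_commutator_eq_zero_of_cmCurve`.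
[cite: MoonenZarhin1999LowDim, §3 (3.1) and Lemma (3.6)] -/
theorem WeilProductCM.restrict₂_commutator_eq_zero_of_abelian (ι₂ : Hom H₂ H) (π₂ : Hom H H₂)
    (hπι₂ : ∀ v, π₂.toLinearMap (ι₂.toLinearMap v) = v)
    (hab₂ : ∀ X ∈ H₂.hodgeLie, ∀ X' ∈ H₂.hodgeLie, X * X' = X' * X)
    {X X' : Module.End ℚ V} (hX : X ∈ H.hodgeLie) (hX' : X' ∈ H.hodgeLie) :
    π₂.toLinearMap ∘ₗ (X * X' - X' * X) ∘ₗ ι₂.toLinearMap = 0 := by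
  rw [LinearMap.sub_comp, LinearMap.comp_sub, restrict_mul ι₂ π₂ hπι₂ hX', restrict_mul ι₂ π₂ hπι₂ hX,
    hab₂ _ (comp_mem_hodgeLie_of_retract ι₂ π₂ hπι₂ hX) _ (comp_mem_hodgeLie_of_retract ι₂ π₂ hπι₂ hX'), sub_self]

/-! ## §2 The brick -/

/-- **`𝔥(H₁ ⊕ H₂)_ℂ` contains every block-diagonal `K`-linear `ψ_ℂ`-skew operator with trace `0` on `W_K` whose `V₂`-corner lies in
`𝔥(H₂)_ℂ`** — `H₂` with ABELIAN Hodge Lie algebra (a CM summand of any rank), `(H, Φ)` balanced = of Weil type, `H₁` with the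
displayed Lie inputs `hLie₁`, `hSL₁` (K1 v1's shapes verbatim).  Binders = K1 v1's in its order, minus the rank-two data of the
CM curve (`hV₂`, `hφ₂E`, `heff₂`), plus `hab₂` and `hY₂`.  Instances: `V₂ = H¹(E_K)` (v1), `H¹(E_K²)` (row 20), `H¹(Z₃)` simple CM
(row 22).  Proof: see the module docstring.  For `H = H¹(Y₃ × Z₃)` (TABLE X row 22)
`hab₂` is «`Z₃` of CM type» and `hY₂` is supplied by the torus maximality of a simple CM threefold; the conclusion is the `hSU`
shape of the cell's blocked Lie-to-group socket.  Nothing about algebraic cycles is proved.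
[cite: MoonenZarhin1999LowDim, §3 (3.1), Lemma (3.6) and Prop. (3.8); §5] [cite: MoonenZarhin1998WeilClasses, §4 Remark (1)]
[cite: Deligne1982HodgeCycles, I §3 Prop. 3.4 and 3.6; §4 (p. 30)] [cite: Ribet1983, Thm. 3] -/
theorem WeilProductCM.mem_hodgeLieC_of_commute_of_skew_of_trace_of_abelian
    (ι₁ : Hom H₁ H) (π₁ : Hom H H₁) (ι₂ : Hom H₂ H) (π₂ : Hom H H₂)
    (hπι₁ : ∀ v, π₁.toLinearMap (ι₁.toLinearMap v) = v) (hπι₂ : ∀ v, π₂.toLinearMap (ι₂.toLinearMap v) = v)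
    (hsum : ∀ v, ι₁.toLinearMap (π₁.toLinearMap v) + ι₂.toLinearMap (π₂.toLinearMap v) = v)
    (hn : n = 1) (heff : H.IsEffective) (ψ : H.Polarization)
    {φ₁ : Module.End ℚ V₁} (hφ₁E : φ₁ ∈ H₁.endAlg) {φ₂ : Module.End ℚ V₂}
    {d : ℚ} (hd : 0 < d) (hφ₁ : φ₁ * φ₁ = -(d • 1)) (hφ₂ : φ₂ * φ₂ = -(d • 1))
    {μ : ℂ} (hμ : μ ^ 2 = -(d : ℂ))
    {Φ : Module.End ℚ V} (hΦE : Φ ∈ H.endAlg) (hΦ₁ : Φ ∘ₗ ι₁.toLinearMap = ι₁.toLinearMap ∘ₗ φ₁)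
    (hΦ₂ : Φ ∘ₗ ι₂.toLinearMap = ι₂.toLinearMap ∘ₗ φ₂)
    (hbal : Module.finrank ℂ ↥(Module.End.eigenspace (Φ.baseChange ℂ) μ ⊓ H.piece 1 0) =
      Module.finrank ℂ ↥(Module.End.eigenspace (Φ.baseChange ℂ) μ ⊓ H.piece 0 1))
    (hbal' : Module.finrank ℂ ↥(Module.End.eigenspace (Φ.baseChange ℂ) (-μ) ⊓ H.piece 1 0) =
      Module.finrank ℂ ↥(Module.End.eigenspace (Φ.baseChange ℂ) (-μ) ⊓ H.piece 0 1))
    {Θ₁ : Module.End ℂ (ℂ ⊗[ℚ] V₁)} (hΘ₁ : ∀ p, ∀ x ∈ H₁.piece p (n - p), Θ₁ x = ((2 * p - n : ℤ) : ℂ) • x)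
    (hLie₁ : ∀ (ψ₁ : H₁.Polarization) (𝔤₁ : Submodule ℚ (Module.End ℚ V₁)),
      (∀ X ∈ 𝔤₁, ∀ X' ∈ 𝔤₁, X * X' - X' * X ∈ 𝔤₁) → Θ₁ ∈ spanC 𝔤₁ →
      (∀ X ∈ 𝔤₁, ∀ a : H₁.endAlg, X * (a : Module.End ℚ V₁) = (a : Module.End ℚ V₁) * X) →
      (∀ X ∈ 𝔤₁, ∀ v w, ψ₁.form (X v) w + ψ₁.form v (X w) = 0) →
      ∀ T : Module.End ℂ (ℂ ⊗[ℚ] V₁), T * φ₁.baseChange ℂ = φ₁.baseChange ℂ * T →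
        (∀ x y, ψ₁.form.baseChange ℂ (T x) y + ψ₁.form.baseChange ℂ x (T y) = 0) → T ∈ spanC 𝔤₁)
    (hSL₁ : ∀ (ψ₁ : H₁.Polarization) (T : Module.End ℂ (ℂ ⊗[ℚ] V₁)),
      T * φ₁.baseChange ℂ = φ₁.baseChange ℂ * T →
      (∀ x y, ψ₁.form.baseChange ℂ (T x) y + ψ₁.form.baseChange ℂ x (T y) = 0) →
      LinearMap.trace ℂ _ (φ₁.baseChange ℂ * T) = 0 →
      T ∈ Submodule.span ℂ {D : Module.End ℂ (ℂ ⊗[ℚ] V₁) | ∃ A B : Module.End ℂ (ℂ ⊗[ℚ] V₁),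
        A * φ₁.baseChange ℂ = φ₁.baseChange ℂ * A ∧ B * φ₁.baseChange ℂ = φ₁.baseChange ℂ * B ∧
        (∀ x y, ψ₁.form.baseChange ℂ (A x) y + ψ₁.form.baseChange ℂ x (A y) = 0) ∧
        (∀ x y, ψ₁.form.baseChange ℂ (B x) y + ψ₁.form.baseChange ℂ x (B y) = 0) ∧ D = A * B - B * A})
    (hab₂ : ∀ X ∈ H₂.hodgeLie, ∀ X' ∈ H₂.hodgeLie, X * X' = X' * X)
    {Y : Module.End ℂ (ℂ ⊗[ℚ] V)}
    (hYe : Y * (ι₁.toLinearMap ∘ₗ π₁.toLinearMap).baseChange ℂ = (ι₁.toLinearMap ∘ₗ π₁.toLinearMap).baseChange ℂ * Y)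
    (hYΦ : Y * Φ.baseChange ℂ = Φ.baseChange ℂ * Y)
    (hYskew : ∀ x y, ψ.form.baseChange ℂ (Y x) y + ψ.form.baseChange ℂ x (Y y) = 0)
    (hYtr : LinearMap.trace ℂ _ (Y.restrict fun x (hx : x ∈ Module.End.eigenspace (Φ.baseChange ℂ) μ) =>
        UnitaryTheta.apply_mem_eigenspace_of_commute hYΦ hx) = 0)
    (hY₂ : π₂.toLinearMap.baseChange ℂ ∘ₗ Y ∘ₗ ι₂.toLinearMap.baseChange ℂ ∈ H₂.hodgeLieC) :
    Y ∈ H.hodgeLieC := by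
  classical
  subst hn
  obtain ⟨hμ0, -⟩ := UnitaryTheta.conj_eq_neg_of_sq hd hμ
  -- §A notation and the splitting identities (as K1 v1)
  set i₁ := ι₁.toLinearMap.baseChange ℂ with hi₁
  set p₁ := π₁.toLinearMap.baseChange ℂ with hp₁
  set i₂ := ι₂.toLinearMap.baseChange ℂ with hi₂
  set p₂ := π₂.toLinearMap.baseChange ℂ with hp₂
  set ΦC := Φ.baseChange ℂ with hΦC
  set φ₁C := φ₁.baseChange ℂ with hφ₁C
  set φ₂C := φ₂.baseChange ℂ with hφ₂C
  set ψC := ψ.form.baseChange ℂ with hψC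
  set e₁ := (ι₁.toLinearMap ∘ₗ π₁.toLinearMap).baseChange ℂ with he₁
  have hπι₁' : π₁.toLinearMap ∘ₗ ι₁.toLinearMap = LinearMap.id := LinearMap.ext hπι₁
  have hπι₂' : π₂.toLinearMap ∘ₗ ι₂.toLinearMap = LinearMap.id := LinearMap.ext hπι₂
  have h21 : π₂.toLinearMap ∘ₗ ι₁.toLinearMap = 0 := LinearMap.ext fun v => by
    have h := congrArg π₂.toLinearMap (hsum (ι₁.toLinearMap v))
    rw [map_add, hπι₁ v, hπι₂] at h
    exact add_eq_left.1 h
  have h12 : π₁.toLinearMap ∘ₗ ι₂.toLinearMap = 0 := LinearMap.ext fun v => by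
    have h := congrArg π₁.toLinearMap (hsum (ι₂.toLinearMap v))
    rw [map_add, hπι₂ v, hπι₁] at h
    exact add_eq_left.1 h
  have hsum' : ι₁.toLinearMap ∘ₗ π₁.toLinearMap + ι₂.toLinearMap ∘ₗ π₂.toLinearMap = LinearMap.id := LinearMap.ext hsum
  have hpi₁ : ∀ x, p₁ (i₁ x) = x := proj_incl_baseChange hπι₁'
  have hpi₂ : ∀ x, p₂ (i₂ x) = x := proj_incl_baseChange hπι₂'
  have hp₂i₁ : ∀ x, p₂ (i₁ x) = 0 := proj_incl_baseChange_eq_zero h21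
  have hp₁i₂ : ∀ x, p₁ (i₂ x) = 0 := proj_incl_baseChange_eq_zero h12
  have hsumC : ∀ y, i₁ (p₁ y) + i₂ (p₂ y) = y := incl_proj_add_baseChange hsum'
  have he₁' : e₁ = i₁ ∘ₗ p₁ := by rw [he₁, LinearMap.baseChange_comp]
  have he₁x : ∀ x, e₁ x = i₁ (p₁ x) := fun x => by rw [he₁', LinearMap.comp_apply]
  -- `Φ ι_i = ι_i φ_i`, `π_i Φ = φ_i π_i`, `Φ² = -d`
  have hΦi₁ : ∀ x, ΦC (i₁ x) = i₁ (φ₁C x) := fun x => by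
    rw [hΦC, hi₁, ← LinearMap.comp_apply, ← LinearMap.baseChange_comp, hΦ₁, LinearMap.baseChange_comp,
      LinearMap.comp_apply]
  have hΦi₂ : ∀ x, ΦC (i₂ x) = i₂ (φ₂C x) := fun x => by
    rw [hΦC, hi₂, ← LinearMap.comp_apply, ← LinearMap.baseChange_comp, hΦ₂, LinearMap.baseChange_comp,
      LinearMap.comp_apply]
  have hΦy : ∀ y, ΦC y = i₁ (φ₁C (p₁ y)) + i₂ (φ₂C (p₂ y)) := fun y => by
    conv_lhs => rw [← hsumC y]
    rw [map_add, hΦi₁, hΦi₂]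
  have hp₁Φ : ∀ y, p₁ (ΦC y) = φ₁C (p₁ y) := fun y => by
    rw [hΦy, map_add, hpi₁, hp₁i₂, add_zero]
  have hp₂Φ : ∀ y, p₂ (ΦC y) = φ₂C (p₂ y) := fun y => by
    rw [hΦy, map_add, hp₂i₁, hpi₂, zero_add]
  have hΦv : ∀ v, Φ v = ι₁.toLinearMap (φ₁ (π₁.toLinearMap v)) + ι₂.toLinearMap (φ₂ (π₂.toLinearMap v)) := fun v => by
    conv_lhs => rw [← hsum v]
    rw [map_add, ← LinearMap.comp_apply Φ ι₁.toLinearMap, hΦ₁, ← LinearMap.comp_apply Φ ι₂.toLinearMap, hΦ₂,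
      LinearMap.comp_apply, LinearMap.comp_apply]
  have hΦ2 : Φ * Φ = -(d • 1) := by
    refine LinearMap.ext fun v => ?_
    rw [Module.End.mul_apply, hΦv (Φ v)]
    have h1 : π₁.toLinearMap (Φ v) = φ₁ (π₁.toLinearMap v) := by
      rw [hΦv v, map_add, hπι₁, ← LinearMap.comp_apply π₁.toLinearMap ι₂.toLinearMap, h12, LinearMap.zero_apply, add_zero]
    have h2 : π₂.toLinearMap (Φ v) = φ₂ (π₂.toLinearMap v) := by
      rw [hΦv v, map_add, hπι₂, ← LinearMap.comp_apply π₂.toLinearMap ι₁.toLinearMap, h21, LinearMap.zero_apply, zero_add]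
    rw [h1, h2, ← Module.End.mul_apply φ₁ φ₁, hφ₁, ← Module.End.mul_apply φ₂ φ₂, hφ₂, LinearMap.neg_apply,
      LinearMap.neg_apply, LinearMap.neg_apply, LinearMap.smul_apply, LinearMap.smul_apply, LinearMap.smul_apply,
      Module.End.one_apply, Module.End.one_apply, Module.End.one_apply, map_neg, map_neg, map_smul, map_smul,
      ← neg_add, ← smul_add, hsum v]
  -- §B the Hodge operator `Θ_H ∈ 𝔥(H)_ℂ`, its corner `π₁ Θ_H ι₁ = Θ₁`
  obtain ⟨Θ, hΘ⟩ := exists_hodgeTheta H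
  have hΘC : Θ ∈ H.hodgeLieC := H.mem_hodgeLieC_of_forall_piece hΘ
  have hΘΦ : Θ * ΦC = ΦC * Θ := commute_baseChange_of_mem_hodgeLieC H hΘC ⟨Φ, hΦE⟩
  have he₁E : ι₁.toLinearMap ∘ₗ π₁.toLinearMap ∈ H.endAlg := Hom.toLinearMap_mem_endAlg (ι₁.comp π₁)
  have hι₁F : ∀ p, ∀ x ∈ H₁.piece p (1 - p), ι₁.toLinearMap.baseChange ℂ x ∈ H.piece p (1 - p) :=
    fun p x hx => ι₁.map_piece_le p _ ⟨x, hx, rfl⟩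
  have hΘι₁ := theta_incl_eq H H₁ hι₁F hΘ hΘ₁
  have hpΘi₁ : ∀ x, p₁ (Θ (i₁ x)) = Θ₁ x := fun x => by rw [hΘι₁, hpi₁]
  -- §C restricted polarizations
  obtain ⟨ψ₁, hψ₁⟩ := WeilProductCM.exists_polarization_comp ι₁ π₁ hπι₁ ψ
  obtain ⟨ψ₂, -⟩ := WeilProductCM.exists_polarization_comp ι₂ π₂ hπι₂ ψ
  have hψ₁C : ∀ x y, ψ₁.form.baseChange ℂ x y = ψC (i₁ x) (i₁ y) := fun x y => by
    rw [hψ₁, baseChange_compl₁₂]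
  -- §D blocks of block-diagonal operators
  have hblk : ∀ Z : Module.End ℂ (ℂ ⊗[ℚ] V), Z * e₁ = e₁ * Z →
      (∀ x, i₁ (p₁ (Z (i₁ x))) = Z (i₁ x)) ∧ (∀ x, i₂ (p₂ (Z (i₂ x))) = Z (i₂ x)) := by
    intro Z hZe
    have hZe' : ∀ x, Z (e₁ x) = e₁ (Z x) := fun x => by rw [← Module.End.mul_apply, hZe, Module.End.mul_apply]
    refine ⟨fun x => ?_, fun x => ?_⟩
    · rw [← he₁x, ← hZe', he₁x, hpi₁]
    · have h1 : i₁ (p₁ (Z (i₂ x))) = 0 := by rw [← he₁x, ← hZe', he₁x, hp₁i₂, map_zero, map_zero]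
      have h2 := hsumC (Z (i₂ x))
      rwa [h1, zero_add] at h2
  -- §E an element `X ∈ 𝔥(H)_ℂ` with the `V₂`-corner of `Y` (corner surjectivity by rigidity, hypothesis `hY₂`)
  obtain ⟨X, hXC, hXcorner⟩ := WeilProductCM.exists_mem_hodgeLieC_restrict₂_eq ι₂ π₂ hπι₂ ψ₂ hY₂
  have hXe : X * e₁ = e₁ * X := commute_baseChange_of_mem_hodgeLieC H hXC ⟨_, he₁E⟩
  have hXΦ : X * ΦC = ΦC * X := commute_baseChange_of_mem_hodgeLieC H hXC ⟨Φ, hΦE⟩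
  have hXskew : ∀ x y, ψC (X x) y + ψC x (X y) = 0 := fun x y => by
    rw [hψC, formBaseChange_skew_of_mem_hodgeLieC ψ hXC, neg_add_cancel]
  have hXcorner' : ∀ x, p₂ (X (i₂ x)) = p₂ (Y (i₂ x)) := fun x => by
    have h := LinearMap.congr_fun hXcorner x
    simpa only [LinearMap.comp_apply] using h
  -- §F the operator `Z = Y - X` with zero `V₂`-block
  obtain ⟨Z, hZdef⟩ : ∃ Z : Module.End ℂ (ℂ ⊗[ℚ] V), Z = Y - X := ⟨_, rfl⟩
  have hZ₂ : ∀ x, p₂ (Z (i₂ x)) = 0 := fun x => by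
    rw [hZdef, LinearMap.sub_apply, map_sub, hXcorner', sub_self]
  have hZe : Z * e₁ = e₁ * Z := by rw [hZdef, sub_mul, mul_sub, hYe, hXe]
  have hZΦ : Z * ΦC = ΦC * Z := by rw [hZdef, sub_mul, mul_sub, hYΦ, hXΦ]
  have hZskew : ∀ x y, ψC (Z x) y + ψC x (Z y) = 0 := fun x y => by
    rw [hZdef, LinearMap.sub_apply, LinearMap.sub_apply, map_sub, LinearMap.sub_apply, map_sub]
    linear_combination hYskew x y - hXskew x y
  obtain ⟨hZi₁, hZi₂⟩ := hblk Z hZe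
  -- the corner `T = π₁ Z ι₁` and `Z = ι₁ T π₁`
  obtain ⟨T, hTdef⟩ : ∃ T : Module.End ℂ (ℂ ⊗[ℚ] V₁), T = p₁ ∘ₗ Z ∘ₗ i₁ := ⟨_, rfl⟩
  have hTx : ∀ x, T x = p₁ (Z (i₁ x)) := fun x => by rw [hTdef, LinearMap.comp_apply, LinearMap.comp_apply]
  have hZT : Z = i₁ ∘ₗ T ∘ₗ p₁ := by
    refine LinearMap.ext fun y => ?_
    rw [LinearMap.comp_apply, LinearMap.comp_apply, hTx, hZi₁]
    conv_lhs => rw [← hsumC y]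
    rw [map_add, ← hZi₂ (p₂ y), hZ₂, map_zero, add_zero]
  have hTφ : T * φ₁C = φ₁C * T := by
    refine LinearMap.ext fun x => ?_
    rw [Module.End.mul_apply, Module.End.mul_apply, hTx, hTx, ← hΦi₁, ← Module.End.mul_apply Z ΦC, hZΦ,
      Module.End.mul_apply, hp₁Φ]
  have hTskew : ∀ x y, ψ₁.form.baseChange ℂ (T x) y + ψ₁.form.baseChange ℂ x (T y) = 0 := fun x y => by
    rw [hψ₁C, hψ₁C, hTx, hTx, hZi₁, hZi₁]
    exact hZskew _ _
  -- §G traces: `tr(φ₁,ℂ T) = tr(Φ_ℂ Z) = tr(Φ_ℂ Y) - tr(Φ_ℂ X) = 0 - 0`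
  have hN : ψC.Nondegenerate :=
    ⟨fun _ hx => ψ.eq_zero_of_forall_form_eq_zero hx, fun _ hy => ψ.eq_zero_of_forall_form_eq_zero' hy⟩
  have htrY : LinearMap.trace ℂ _ Y = 0 := WeilProductCM.trace_eq_zero_of_skew hN hYskew
  have htrΦY : LinearMap.trace ℂ _ (ΦC * Y) = 0 := by
    have h := WeilProductCM.two_mul_mul_trace_restrict_eq hd hΦ2 hμ hYΦ
      (fun x hx => UnitaryTheta.apply_mem_eigenspace_of_commute hYΦ hx)
    rw [hYtr, htrY, mul_zero, mul_zero, zero_add] at h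
    exact h.symm
  have htrΦΘ : LinearMap.trace ℂ _ (ΦC * Θ) = 0 := by
    rw [← hΘΦ, hΦC, trace_theta_mul_baseChange_eq_of_sq_eq_neg H rfl heff hΦE hd hΦ2 hμ hΘ, hbal, hbal', sub_self, sub_self,
      mul_zero, sub_zero]
  have htrΦX : LinearMap.trace ℂ _ (ΦC * X) = 0 :=
    WeilProductCM.trace_mul_eq_zero_of_mem_hodgeLieC_of_trace_theta H ψ hΦE hΘ htrΦΘ hXC
  have htrΦZ : LinearMap.trace ℂ _ (ΦC * Z) = 0 := by
    rw [hZdef, mul_sub, map_sub, htrΦY, htrΦX, sub_zero]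
  -- block traces
  have hZ₂' : p₂ ∘ₗ Z ∘ₗ i₂ = 0 := LinearMap.ext fun x => by
    rw [LinearMap.comp_apply, LinearMap.comp_apply, hZ₂, LinearMap.zero_apply]
  have htr₁ : LinearMap.trace ℂ _ (φ₁C * T) = LinearMap.trace ℂ _ ((ΦC * Z) ∘ₗ (i₁ ∘ₗ p₁)) := by
    have h : φ₁C * T = p₁ ∘ₗ ((ΦC * Z) ∘ₗ i₁) := by
      refine LinearMap.ext fun x => ?_
      rw [Module.End.mul_apply, hTx, LinearMap.comp_apply, LinearMap.comp_apply, Module.End.mul_apply, hp₁Φ]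
    rw [h, ← LinearMap.trace_comp_comm', LinearMap.comp_assoc]
  have htr₂ : LinearMap.trace ℂ _ ((ΦC * Z) ∘ₗ (i₂ ∘ₗ p₂)) = 0 := by
    have h : p₂ ∘ₗ ((ΦC * Z) ∘ₗ i₂) = 0 := by
      refine LinearMap.ext fun x => ?_
      rw [LinearMap.comp_apply, LinearMap.comp_apply, Module.End.mul_apply, hp₂Φ, hZ₂, map_zero, LinearMap.zero_apply]
    rw [← LinearMap.comp_assoc, LinearMap.trace_comp_comm', h, map_zero]
  have hTtr : LinearMap.trace ℂ _ (φ₁C * T) = 0 := by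
    have hsplit : ΦC * Z = (ΦC * Z) ∘ₗ (i₁ ∘ₗ p₁) + (ΦC * Z) ∘ₗ (i₂ ∘ₗ p₂) := by
      rw [← LinearMap.comp_add, ← LinearMap.baseChange_comp, ← LinearMap.baseChange_comp, ← LinearMap.baseChange_add, hsum',
        LinearMap.baseChange_id, LinearMap.comp_id]
    have h : LinearMap.trace ℂ _ (ΦC * Z) =
        LinearMap.trace ℂ _ ((ΦC * Z) ∘ₗ (i₁ ∘ₗ p₁)) + LinearMap.trace ℂ _ ((ΦC * Z) ∘ₗ (i₂ ∘ₗ p₂)) := by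
      conv_lhs => rw [hsplit]
      rw [map_add]
    rw [htr₂, add_zero, htrΦZ] at h
    rw [htr₁, ← h]
  -- §H the corner algebra `𝔤₁ = π₁ 𝔥(H) ι₁` is admissible and `Θ₁ ∈ spanC 𝔤₁`
  let r₁ : Module.End ℚ V →ₗ[ℚ] Module.End ℚ V₁ :=
    (LinearMap.llcomp ℚ _ _ _ π₁.toLinearMap).comp (LinearMap.lcomp ℚ _ ι₁.toLinearMap)
  have hr₁ : ∀ X', r₁ X' = π₁.toLinearMap ∘ₗ X' ∘ₗ ι₁.toLinearMap := fun X' => rfl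
  obtain ⟨𝔤₁, h𝔤₁def⟩ : ∃ 𝔤₁ : Submodule ℚ (Module.End ℚ V₁), 𝔤₁ = H.hodgeLie.map r₁ := ⟨_, rfl⟩
  have h𝔤₁ : ∀ X₁ ∈ 𝔤₁, ∃ X' ∈ H.hodgeLie, π₁.toLinearMap ∘ₗ X' ∘ₗ ι₁.toLinearMap = X₁ := fun X₁ h => by
    rw [h𝔤₁def] at h
    obtain ⟨X', hX', rfl⟩ := Submodule.mem_map.1 h
    exact ⟨X', hX', rfl⟩
  have hmem𝔤₁ : ∀ X' ∈ H.hodgeLie, π₁.toLinearMap ∘ₗ X' ∘ₗ ι₁.toLinearMap ∈ 𝔤₁ := fun X' hX' => by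
    rw [h𝔤₁def]
    exact Submodule.mem_map.2 ⟨X', hX', rfl⟩
  have hbr : ∀ X₁ ∈ 𝔤₁, ∀ X₁' ∈ 𝔤₁, X₁ * X₁' - X₁' * X₁ ∈ 𝔤₁ := by
    intro X₁ h X₁' h'
    obtain ⟨X', hX', rfl⟩ := h𝔤₁ X₁ h
    obtain ⟨X'', hX'', rfl⟩ := h𝔤₁ X₁' h'
    rw [← restrict_mul ι₁ π₁ hπι₁ hX'', ← restrict_mul ι₁ π₁ hπι₁ hX', ← LinearMap.comp_sub, ← LinearMap.sub_comp]
    exact hmem𝔤₁ _ (H.commutator_mem_hodgeLie hX' hX'')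
  have hcomm : ∀ X₁ ∈ 𝔤₁, ∀ a : H₁.endAlg, X₁ * (a : Module.End ℚ V₁) = (a : Module.End ℚ V₁) * X₁ := fun X₁ h a => by
    obtain ⟨X', hX', rfl⟩ := h𝔤₁ X₁ h
    exact commute_of_mem_hodgeLie H₁ (comp_mem_hodgeLie_of_retract ι₁ π₁ hπι₁ hX') a
  have hskew₁ : ∀ X₁ ∈ 𝔤₁, ∀ v w, ψ₁.form (X₁ v) w + ψ₁.form v (X₁ w) = 0 := fun X₁ h v w => by
    obtain ⟨X', hX', rfl⟩ := h𝔤₁ X₁ h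
    exact form_apply_add_eq_zero_of_mem_hodgeLie ψ₁ (comp_mem_hodgeLie_of_retract ι₁ π₁ hπι₁ hX') v w
  have hcornerC : ∀ Z' ∈ H.hodgeLieC, p₁ ∘ₗ Z' ∘ₗ i₁ ∈ spanC 𝔤₁ := by
    intro Z' hZ'
    induction hZ' using Submodule.span_induction with
    | mem Z' h =>
      obtain ⟨X', hX', rfl⟩ := h
      rw [hp₁, hi₁, ← LinearMap.baseChange_comp, ← LinearMap.baseChange_comp]
      exact baseChange_mem_spanC (hmem𝔤₁ X' hX')
    | zero => rw [LinearMap.zero_comp, LinearMap.comp_zero]; exact Submodule.zero_mem _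
    | add Z' Z'' _ _ h h' => rw [LinearMap.add_comp, LinearMap.comp_add]; exact Submodule.add_mem _ h h'
    | smul a Z' _ h => rw [LinearMap.smul_comp, LinearMap.comp_smul]; exact Submodule.smul_mem _ a h
  have hΘ𝔤₁ : Θ₁ ∈ spanC 𝔤₁ := by
    have h := hcornerC Θ hΘC
    have hΘ₁eq : p₁ ∘ₗ Θ ∘ₗ i₁ = Θ₁ :=
      LinearMap.ext fun x => by rw [LinearMap.comp_apply, LinearMap.comp_apply, hpΘi₁]
    rwa [hΘ₁eq] at h
  have hU₁ := hLie₁ ψ₁ 𝔤₁ hbr hΘ𝔤₁ hcomm hskew₁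
  -- §I brackets of corners lift: `ι₁ [π₁X'ι₁, π₁X″ι₁] π₁ = [X', X″] ∈ 𝔥(H)` (zero `V₂`-corner by `hab₂`)
  let ℓ : Module.End ℂ (ℂ ⊗[ℚ] V₁) →ₗ[ℂ] Module.End ℂ (ℂ ⊗[ℚ] V) :=
    (LinearMap.llcomp ℂ _ _ _ i₁).comp (LinearMap.lcomp ℂ _ p₁)
  have hℓ : ∀ D, ℓ D = i₁ ∘ₗ D ∘ₗ p₁ := fun D => rfl
  have hliftQ : ∀ X' ∈ H.hodgeLie, ∀ X'' ∈ H.hodgeLie,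
      ι₁.toLinearMap ∘ₗ ((π₁.toLinearMap ∘ₗ X' ∘ₗ ι₁.toLinearMap) * (π₁.toLinearMap ∘ₗ X'' ∘ₗ ι₁.toLinearMap) -
        (π₁.toLinearMap ∘ₗ X'' ∘ₗ ι₁.toLinearMap) * (π₁.toLinearMap ∘ₗ X' ∘ₗ ι₁.toLinearMap)) ∘ₗ π₁.toLinearMap =
      X' * X'' - X'' * X' := by
    intro X' hX' X'' hX''
    have hCmem : X' * X'' - X'' * X' ∈ H.hodgeLie := H.commutator_mem_hodgeLie hX' hX''
    rw [← restrict_mul ι₁ π₁ hπι₁ hX'', ← restrict_mul ι₁ π₁ hπι₁ hX', ← LinearMap.comp_sub, ← LinearMap.sub_comp]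
    have h1 := comp_incl_eq_incl_comp_restrict ι₁ π₁ hπι₁ hCmem
    have h2 := comp_incl_eq_incl_comp_restrict ι₂ π₂ hπι₂ hCmem
    rw [WeilProductCM.restrict₂_commutator_eq_zero_of_abelian ι₂ π₂ hπι₂ hab₂ hX' hX'', LinearMap.comp_zero] at h2
    have h1v : ∀ w, (X' * X'' - X'' * X') (ι₁.toLinearMap w) =
        ι₁.toLinearMap (π₁.toLinearMap ((X' * X'' - X'' * X') (ι₁.toLinearMap w))) := fun w => by
      have h := LinearMap.congr_fun h1 w
      simpa only [LinearMap.comp_apply] using h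
    have h2v : ∀ w, (X' * X'' - X'' * X') (ι₂.toLinearMap w) = 0 := fun w => by
      have h := LinearMap.congr_fun h2 w
      simpa only [LinearMap.comp_apply, LinearMap.zero_apply] using h
    refine LinearMap.ext fun v => ?_
    rw [LinearMap.comp_apply, LinearMap.comp_apply, LinearMap.comp_apply, LinearMap.comp_apply, ← h1v]
    conv_rhs => rw [← hsum v]
    rw [map_add, h2v, add_zero]
  have hlift : ∀ A ∈ spanC 𝔤₁, ∀ B ∈ spanC 𝔤₁, ℓ (A * B - B * A) ∈ H.hodgeLieC := by
    let f : Module.End ℂ (ℂ ⊗[ℚ] V₁) →ₗ[ℂ] Module.End ℂ (ℂ ⊗[ℚ] V₁) →ₗ[ℂ] Module.End ℂ (ℂ ⊗[ℚ] V) :=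
      LinearMap.mk₂ ℂ (fun A B => ℓ (A * B - B * A))
        (fun A A' B => by rw [add_mul, mul_add, ← map_add]; congr 1; abel)
        (fun a A B => by rw [smul_mul_assoc, mul_smul_comm, ← smul_sub, map_smul])
        (fun A B B' => by rw [mul_add, add_mul, ← map_add]; congr 1; abel)
        (fun a A B => by rw [mul_smul_comm, smul_mul_assoc, ← smul_sub, map_smul])
    have hf : ∀ A B, f A B = ℓ (A * B - B * A) := fun A B => rfl
    intro A hA B hB
    rw [← hf]
    have hle : Submodule.map₂ f (spanC 𝔤₁) (spanC 𝔤₁) ≤ H.hodgeLieC := by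
      change Submodule.map₂ f (Submodule.span ℂ _) (Submodule.span ℂ _) ≤ _
      rw [Submodule.map₂_span_span, Submodule.span_le]
      rintro _ ⟨_, ⟨X₁, hX₁, rfl⟩, _, ⟨X₁', hX₁', rfl⟩, rfl⟩
      obtain ⟨X', hX', rfl⟩ := h𝔤₁ X₁ hX₁
      obtain ⟨X'', hX'', rfl⟩ := h𝔤₁ X₁' hX₁'
      change f ((π₁.toLinearMap ∘ₗ X' ∘ₗ ι₁.toLinearMap).baseChange ℂ)
        ((π₁.toLinearMap ∘ₗ X'' ∘ₗ ι₁.toLinearMap).baseChange ℂ) ∈ H.hodgeLieC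
      rw [hf, hℓ, ← LinearMap.baseChange_mul, ← LinearMap.baseChange_mul, ← LinearMap.baseChange_sub, hi₁, hp₁,
        ← LinearMap.baseChange_comp, ← LinearMap.baseChange_comp, hliftQ X' hX' X'' hX'']
      exact baseChange_mem_hodgeLieC H (H.commutator_mem_hodgeLie hX' hX'')
    exact hle (Submodule.apply_mem_map₂ f hA hB)
  -- §J conclusion: `T ∈ span [𝔲₁, 𝔲₁]` (hSL₁), `𝔲₁ = spanC 𝔤₁` (hLie₁), so `ι₁ T π₁ ∈ 𝔥(H)_ℂ`; `Y = X + ι₁ T π₁`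
  have hT := hSL₁ ψ₁ T hTφ hTskew hTtr
  have hℓT : ℓ T ∈ H.hodgeLieC := by
    have hle : Submodule.span ℂ {D : Module.End ℂ (ℂ ⊗[ℚ] V₁) | ∃ A B : Module.End ℂ (ℂ ⊗[ℚ] V₁),
        A * φ₁.baseChange ℂ = φ₁.baseChange ℂ * A ∧ B * φ₁.baseChange ℂ = φ₁.baseChange ℂ * B ∧
        (∀ x y, ψ₁.form.baseChange ℂ (A x) y + ψ₁.form.baseChange ℂ x (A y) = 0) ∧
        (∀ x y, ψ₁.form.baseChange ℂ (B x) y + ψ₁.form.baseChange ℂ x (B y) = 0) ∧ D = A * B - B * A} ≤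
        H.hodgeLieC.comap ℓ := by
      rw [Submodule.span_le]
      rintro D ⟨A, B, hA, hB, hAs, hBs, rfl⟩
      exact hlift A (hU₁ A hA hAs) B (hU₁ B hB hBs)
    exact hle hT
  have hY : Y = X + ℓ T := by
    rw [hℓ, ← hZT, hZdef, add_sub_cancel]
  rw [hY]
  exact Submodule.add_mem _ hXC hℓT

end HodgeStructure

end Literature.AlgebraicGeometry.Motives

end
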